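import Literature.Computability.AlgebraicComplexity.PopovStabilityCriterionTensor
import Literature.Computability.AlgebraicComplexity.BI17GenericPeriodThreeProofs
import Literature.Computability.AlgebraicComplexity.BI17PeriodExponentBoundProofs
import Mathlib.RingTheory.RootsOfUnity.Basic
import HarnessLib

/-!
# BI 2017, Prop. 4.10 and Cor. 5.12 from Popov's theorems, BY NAME (edges; no strike)

P. Bürgisser, C. Ikenmeyer, *Fundamental invariants of orbit closures*, J. Algebra **477** (2017)
390–434 = arXiv:1511.02927 [BurgisserIkenmeyer2017], Prop. 4.10 (L1923, p0017:L69: "Almost all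
`w ∈ ⊗³ℂ^m` are polystable"), printed proof L1927–1937: Thm. 4.2 ("the reduced stabilizer
`stab'(w) = stab(w)/K` is finite for almost all `w`") + Popov's stability criterion for the
semisimple group `G_s = SL_m³/K` ("[Luna 1973], or [Kraft 1984]"). THEOREMS ONLY (no definition, no
new named fact). The named facts `BI2017_prop_4_10` and `BI2017_cor_5_12`
(`BI17FundamentalInvariantTensors.lean`, val-lit row BI2017-B) are NOT restated and NOT struck; this
file records exactly what they hang on:

* `finite_slTensorStab_of_hasTrivialTensorStabilizer` — a tensor with trivial (reduced) stabilizer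
  has a FINITE `SL_m³`-stabilizer: its elements are `(ζ₁I, ζ₂I, ζ₃I)` with `ζᵢ^m = det = 1`.
* `isZariskiGenericTensor_finite_slTensorStab_of_popov87` — hence A. M. Popov's 1987 theorem
  (`BI2017_popov_trivialStabilizer`, generic trivial stabilizer for `m > 3`) gives the generic
  finiteness hypothesis of Popov's 1970 criterion for `m ≥ 4`.
* `isPolystableTensor_of_subsingleton`, `isZariskiGenericTensor_isPolystableTensor_of_le_one` — the
  degenerate formats `m ≤ 1` (`SL_m = {1}`, every orbit is a point).
* **`BI2017_prop_4_10_of_popov`** — Prop. 4.10 from: the 1970 criterion for `SL_m³` on `⊗³ℂ^m`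
  (`Popov1970_genericClosedOrbit_tensor`, cite-fact), the 1987 generic-trivial-stabilizer theorem
  (`BI2017_popov_trivialStabilizer`, cite-fact), and — the HONEST GAP — generic finiteness of the
  `SL₃³`-stabilizer on `⊗³ℂ³` as an explicit hypothesis (in print via the Thrall–Chanler
  classification of `⊗³ℂ³`; the tree has the generic PERIOD `a(3) = 1`, `BI2017_thm_4_2_three`, not
  the finiteness); `m = 2` is the tree's `BI2017_prop_4_10_two`.
* **`BI2017_cor_5_12_of_popov`** — Cor. 5.12 from the same three inputs, through the tree's
  `BI2017_thm_4_2_of_popov` and `BI2017_cor_5_12_of_thm_4_2_of_prop_4_10` (val-lit-t06).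

Honest framing: typed-literature bookkeeping for the cell `val-lit` (LADDER-VALIANT V3, a
known-results layer); edges, not discharges; nothing here bears on VP versus VNP.

## References

* [BurgisserIkenmeyer2017] arXiv:1511.02927, Prop. 4.10 (proof L1927–1937), Thm. 4.2, Cor. 5.12.
* V. L. Popov, Math. USSR-Izv. 4 (1970) 527–535 (stability criterion); A. M. Popov, Trudy Moskov.
  Mat. Obshch. 50 (1987), Thm. 2 (generic stabilizers) — both as quoted in BI 2017.
-/

noncomputable section

open Matrix

namespace Literature.Computability.AlgebraicComplexity

/-! ### Trivial stabilizer ⇒ finite `SL³`-stabilizer -/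

section FiniteStab

variable {m : ℕ}

/-- The `SL_m³`-stabilizer of a tensor (the set in the hypothesis of
`Popov1970_genericClosedOrbit_tensor`). Local abbreviation-free spelling is used in statements; this
lemma unfolds membership. [cite: BurgisserIkenmeyer2017, §4.1 eq. (4.1)] -/
theorem mem_slTensorStab_iff (w : Fin m → Fin m → Fin m → ℂ)
    (g : Matrix.SpecialLinearGroup (Fin m) ℂ × Matrix.SpecialLinearGroup (Fin m) ℂ × Matrix.SpecialLinearGroup (Fin m) ℂ) :
    g ∈ {g : Matrix.SpecialLinearGroup (Fin m) ℂ × Matrix.SpecialLinearGroup (Fin m) ℂ ×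
          Matrix.SpecialLinearGroup (Fin m) ℂ |
        actTensor (g.1 : Matrix (Fin m) (Fin m) ℂ) (g.2.1 : Matrix (Fin m) (Fin m) ℂ)
          (g.2.2 : Matrix (Fin m) (Fin m) ℂ) w = w} ↔
      actTensor (g.1 : Matrix (Fin m) (Fin m) ℂ) (g.2.1 : Matrix (Fin m) (Fin m) ℂ)
        (g.2.2 : Matrix (Fin m) (Fin m) ℂ) w = w :=
  Iff.rfl

/-- **A tensor with trivial stabilizer has a finite `SL_m³`-stabilizer** (`m ≥ 1`): if every
`g ∈ stab(w) ⊆ GL_m³` is a scalar triple `(ζ₁I, ζ₂I, ζ₃I)` (BI §4.1: `stab'(w) = stab(w)/K` trivial),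
then an `SL_m³`-element stabilizing `w` has `ζᵢ^m = det(ζᵢ I) = 1`, so the stabilizer injects into
`μ_m³`. [cite: BurgisserIkenmeyer2017, §4.1 (L1574–1587) and Prop. 4.10 (proof)] -/
theorem finite_slTensorStab_of_hasTrivialTensorStabilizer (hm : 0 < m)
    {w : Fin m → Fin m → Fin m → ℂ} (hw : HasTrivialTensorStabilizer w) :
    {g : Matrix.SpecialLinearGroup (Fin m) ℂ × Matrix.SpecialLinearGroup (Fin m) ℂ × Matrix.SpecialLinearGroup (Fin m) ℂ |
        actTensor (g.1 : Matrix (Fin m) (Fin m) ℂ) (g.2.1 : Matrix (Fin m) (Fin m) ℂ)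
          (g.2.2 : Matrix (Fin m) (Fin m) ℂ) w = w}.Finite := by
  classical
  set i₀ : Fin m := ⟨0, hm⟩
  -- the `m`-th roots of unity in `ℂ`, a finite set
  set R : Set ℂ := {ζ | ζ ^ m = 1} with hR
  have hRfin : R.Finite := by
    have : R ⊆ ((Polynomial.nthRoots m (1 : ℂ)).toFinset : Set ℂ) := by
      intro ζ hζ
      simp only [Finset.mem_coe, Multiset.mem_toFinset, Polynomial.mem_nthRoots hm]
      exact hζ
    exact (Finset.finite_toSet _).subset this
  -- read off the three scalars from the `(i₀, i₀)` entries
  let f : Matrix.SpecialLinearGroup (Fin m) ℂ × Matrix.SpecialLinearGroup (Fin m) ℂ × Matrix.SpecialLinearGroup (Fin m) ℂ →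
      ℂ × ℂ × ℂ :=
    fun g => ((g.1 : Matrix (Fin m) (Fin m) ℂ) i₀ i₀, (g.2.1 : Matrix (Fin m) (Fin m) ℂ) i₀ i₀,
      (g.2.2 : Matrix (Fin m) (Fin m) ℂ) i₀ i₀)
  -- every stabilizing `SL³`-triple is a scalar triple
  have key : ∀ g ∈ {g : Matrix.SpecialLinearGroup (Fin m) ℂ × Matrix.SpecialLinearGroup (Fin m) ℂ ×
        Matrix.SpecialLinearGroup (Fin m) ℂ |
      actTensor (g.1 : Matrix (Fin m) (Fin m) ℂ) (g.2.1 : Matrix (Fin m) (Fin m) ℂ)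
        (g.2.2 : Matrix (Fin m) (Fin m) ℂ) w = w},
      ∃ ζ₁ ζ₂ ζ₃ : ℂ, (g.1 : Matrix (Fin m) (Fin m) ℂ) = ζ₁ • (1 : Matrix (Fin m) (Fin m) ℂ) ∧
        (g.2.1 : Matrix (Fin m) (Fin m) ℂ) = ζ₂ • (1 : Matrix (Fin m) (Fin m) ℂ) ∧
        (g.2.2 : Matrix (Fin m) (Fin m) ℂ) = ζ₃ • (1 : Matrix (Fin m) (Fin m) ℂ) := by
    intro g hg
    have hGL : ((Matrix.SpecialLinearGroup.toGL g.1, Matrix.SpecialLinearGroup.toGL g.2.1,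
        Matrix.SpecialLinearGroup.toGL g.2.2) : GL (Fin m) ℂ × GL (Fin m) ℂ × GL (Fin m) ℂ) ∈ tensorStab w :=
      (mem_tensorStab_iff w _).2 hg
    obtain ⟨ζ₁, ζ₂, ζ₃, -, h₁, h₂, h₃⟩ := hw _ hGL
    exact ⟨ζ₁, ζ₂, ζ₃, h₁, h₂, h₃⟩
  refine Set.Finite.of_finite_image ?_ ?_ (f := f)
  · -- the image lies in `R × R × R`
    refine (hRfin.prod (hRfin.prod hRfin)).subset ?_
    rintro _ ⟨g, hg, rfl⟩
    obtain ⟨ζ₁, ζ₂, ζ₃, h₁, h₂, h₃⟩ := key g hg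
    have hdet : ∀ (s : Matrix.SpecialLinearGroup (Fin m) ℂ) (ζ : ℂ),
        (s : Matrix (Fin m) (Fin m) ℂ) = ζ • (1 : Matrix (Fin m) (Fin m) ℂ) → ζ ^ m = 1 := by
      intro s ζ hs
      have h := s.det_coe
      rw [hs, Matrix.det_smul, Matrix.det_one, mul_one, Fintype.card_fin] at h
      exact h
    simp only [Set.mem_prod, f, h₁, h₂, h₃, Matrix.smul_apply, Matrix.one_apply_eq, smul_eq_mul,
      mul_one]
    exact ⟨hdet _ _ h₁, hdet _ _ h₂, hdet _ _ h₃⟩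
  · -- `f` is injective on the stabilizer (a scalar matrix is determined by one diagonal entry)
    intro g hg g' hg' hfg
    obtain ⟨ζ₁, ζ₂, ζ₃, h₁, h₂, h₃⟩ := key g hg
    obtain ⟨ζ₁', ζ₂', ζ₃', h₁', h₂', h₃'⟩ := key g' hg'
    simp only [f, h₁, h₂, h₃, h₁', h₂', h₃', Matrix.smul_apply, Matrix.one_apply_eq, smul_eq_mul,
      mul_one, Prod.mk.injEq] at hfg
    obtain ⟨rfl, rfl, rfl⟩ := hfg
    refine Prod.ext (Matrix.SpecialLinearGroup.ext _ _ fun i j => ?_)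
      (Prod.ext (Matrix.SpecialLinearGroup.ext _ _ fun i j => ?_)
        (Matrix.SpecialLinearGroup.ext _ _ fun i j => ?_))
    · rw [h₁, h₁']
    · rw [h₂, h₂']
    · rw [h₃, h₃']

/-- **Popov 1987 ⇒ the finiteness hypothesis of Popov 1970 for `m ≥ 4`**: almost all
`w ∈ ⊗³ℂ^m`, `m > 3`, have a finite `SL_m³`-stabilizer. [cite: BurgisserIkenmeyer2017, Thm. 4.2 (proof) and Prop. 4.10 (proof)] -/
theorem isZariskiGenericTensor_finite_slTensorStab_of_popov87 (h : BI2017_popov_trivialStabilizer)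
    (hm : 3 < m) :
    IsZariskiGenericTensor fun w : Fin m → Fin m → Fin m → ℂ =>
      {g : Matrix.SpecialLinearGroup (Fin m) ℂ × Matrix.SpecialLinearGroup (Fin m) ℂ × Matrix.SpecialLinearGroup (Fin m) ℂ |
        actTensor (g.1 : Matrix (Fin m) (Fin m) ℂ) (g.2.1 : Matrix (Fin m) (Fin m) ℂ)
          (g.2.2 : Matrix (Fin m) (Fin m) ℂ) w = w}.Finite :=
  (h m hm).mono fun _ hw => finite_slTensorStab_of_hasTrivialTensorStabilizer (by omega) hw

end FiniteStab

/-! ### The degenerate formats `m ≤ 1` -/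

section Degenerate

variable {m : ℕ}

/-- For `m ≤ 1` the group `SL_m(ℂ)` is trivial: every element is the identity matrix. [folklore] -/
private theorem sl_coe_eq_one_of_subsingleton [Subsingleton (Fin m)] (g : Matrix.SpecialLinearGroup (Fin m) ℂ) :
    (g : Matrix (Fin m) (Fin m) ℂ) = 1 := by
  ext i j
  obtain rfl : i = j := Subsingleton.elim _ _
  rw [Matrix.one_apply_eq, ← Matrix.det_eq_elem_of_subsingleton (g : Matrix (Fin m) (Fin m) ℂ) i,
    g.det_coe]

/-- For `m ≤ 1` every tensor in `⊗³ℂ^m` is polystable: its `SL_m³`-orbit is the single point `{w}`.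
[cite: BurgisserIkenmeyer2017, §4.2 (Def. of polystable tensor, L1821)] -/
theorem isPolystableTensor_of_subsingleton [Subsingleton (Fin m)] (w : Fin m → Fin m → Fin m → ℂ) :
    IsPolystableTensor w := by
  unfold IsPolystableTensor
  have hconst : (fun g : Matrix.SpecialLinearGroup (Fin m) ℂ × Matrix.SpecialLinearGroup (Fin m) ℂ ×
        Matrix.SpecialLinearGroup (Fin m) ℂ =>
      actTensor (g.1 : Matrix (Fin m) (Fin m) ℂ) (g.2.1 : Matrix (Fin m) (Fin m) ℂ)
        (g.2.2 : Matrix (Fin m) (Fin m) ℂ) w) = fun _ => w := by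
    funext g
    rw [sl_coe_eq_one_of_subsingleton g.1, sl_coe_eq_one_of_subsingleton g.2.1,
      sl_coe_eq_one_of_subsingleton g.2.2, actTensor_one]
  rw [hconst, Set.range_const]
  exact isClosed_singleton

/-- For `m ≤ 1`, "almost all `w ∈ ⊗³ℂ^m` are polystable" holds trivially (all are; witness
polynomial `1`). [cite: BurgisserIkenmeyer2017, Prop. 4.10] -/
theorem isZariskiGenericTensor_isPolystableTensor_of_le_one (hm : m ≤ 1) :
    IsZariskiGenericTensor (IsPolystableTensor : (Fin m → Fin m → Fin m → ℂ) → Prop) := by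
  haveI : Subsingleton (Fin m) := Fin.subsingleton_iff_le_one.2 hm
  exact ⟨1, one_ne_zero, fun w _ => isPolystableTensor_of_subsingleton w⟩

end Degenerate

/-! ### Prop. 4.10 and Cor. 5.12 from Popov's theorems -/

section Edges

/-- **BI 2017, Prop. 4.10 from Popov's theorems, BY NAME.** "Almost all `w ∈ ⊗³ℂ^m` are polystable"
follows from Popov's 1970 stability criterion for `SL_m³` on `⊗³ℂ^m`
(`Popov1970_genericClosedOrbit_tensor`), A. M. Popov's 1987 generic-trivial-stabilizer theorem
(`BI2017_popov_trivialStabilizer`, giving a finite generic `SL_m³`-stabilizer for `m ≥ 4`), and the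
generic finiteness of the `SL₃³`-stabilizer on `⊗³ℂ³` (hypothesis `h3`; in print via the
Thrall–Chanler classification, not in the tree). Cases `m ≤ 1` are trivial, `m = 2` is
`BI2017_prop_4_10_two`. An edge, not a discharge. [cite: BurgisserIkenmeyer2017, Prop. 4.10] -/
theorem BI2017_prop_4_10_of_popov (h70 : Popov1970_genericClosedOrbit_tensor)
    (h87 : BI2017_popov_trivialStabilizer)
    (h3 : IsZariskiGenericTensor fun w : Fin 3 → Fin 3 → Fin 3 → ℂ =>
      {g : Matrix.SpecialLinearGroup (Fin 3) ℂ × Matrix.SpecialLinearGroup (Fin 3) ℂ × Matrix.SpecialLinearGroup (Fin 3) ℂ |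
        actTensor (g.1 : Matrix (Fin 3) (Fin 3) ℂ) (g.2.1 : Matrix (Fin 3) (Fin 3) ℂ)
          (g.2.2 : Matrix (Fin 3) (Fin 3) ℂ) w = w}.Finite) :
    BI2017_prop_4_10 := by
  intro m
  obtain hm | rfl | rfl | hm : m ≤ 1 ∨ m = 2 ∨ m = 3 ∨ 3 < m := by omega
  · exact isZariskiGenericTensor_isPolystableTensor_of_le_one hm
  · exact BI2017_prop_4_10_two
  · exact h70 3 (by norm_num) h3
  · exact h70 m (by omega) (isZariskiGenericTensor_finite_slTensorStab_of_popov87 h87 hm)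

/-- **BI 2017, Cor. 5.12 from Popov's theorems, BY NAME** ("1. `\overline{Gw}` is not normal if
`a(w) < √m`. 2. Let `m ≥ 3`. Then `\overline{Gw}` is not normal for almost all `w ∈ ⊗³ℂ^m`"): part 1
is the tree's theorem (`BI2017_cor_5_12_part1`), part 2 = Thm. 4.2 (from the 1987 theorem,
`BI2017_thm_4_2_of_popov`) + Prop. 4.10 (above) through `BI2017_cor_5_12_of_thm_4_2_of_prop_4_10`.
An edge, not a discharge. [cite: BurgisserIkenmeyer2017, Cor. 5.12] -/
theorem BI2017_cor_5_12_of_popov (h70 : Popov1970_genericClosedOrbit_tensor)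
    (h87 : BI2017_popov_trivialStabilizer)
    (h3 : IsZariskiGenericTensor fun w : Fin 3 → Fin 3 → Fin 3 → ℂ =>
      {g : Matrix.SpecialLinearGroup (Fin 3) ℂ × Matrix.SpecialLinearGroup (Fin 3) ℂ × Matrix.SpecialLinearGroup (Fin 3) ℂ |
        actTensor (g.1 : Matrix (Fin 3) (Fin 3) ℂ) (g.2.1 : Matrix (Fin 3) (Fin 3) ℂ)
          (g.2.2 : Matrix (Fin 3) (Fin 3) ℂ) w = w}.Finite) :
    BI2017_cor_5_12 :=
  BI2017_cor_5_12_of_thm_4_2_of_prop_4_10 (BI2017_thm_4_2_of_popov h87)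
    (BI2017_prop_4_10_of_popov h70 h87 h3)

end Edges

end Literature.Computability.AlgebraicComplexity
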